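import Mathlib
import Summits.MatrixMultiplication.MatrixMultiplication.Theorems.GradedDesignFamily.Negative.FlatBessel
import Summits.MatrixMultiplication.MatrixMultiplication.Theorems.GradedDesignFamily.Negative.FlatGram

/-!
# Sum of squared Gram entries of the flat-size lemma
# (crux `LevelGradedCohnUmans.GradedDesignFamily`, stmt-MatrixMultiplication-7610; negative side,
# line `quadratic-extension-level-one-cell`, stub `gl2Flat_gram_sum_sq_le`)

For a finite field `K` with `Q := |K|` and a finite set `Γ ⊆ GL₂(K)` with `n := |Γ|` put, for
`x, y ∈ Γ`, `n(x, y) := #{u ∈ K² : x·u = y·u}` (the Gram entries of the indicator frame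
`g ↦ [g·u = w]` restricted to `Γ`).  Then

* `gl2Flat_gram_sum_sq_le` —
  `Q · Σ_{x, y ∈ Γ} n(x, y)² ≤ n² (Q² + Q − 1) + n · Q² (Q − 1)(2Q − 1)(Q + 1)`.

Proof (pure counting from two landed lemmas).  Pointwise, for `x, y ∈ Γ`:
`n(x, y)² ≤ (Q + 1) n(x, y) − Q + [x = y] · (Q⁴ − Q³ − Q² + Q)`; indeed for `x ≠ y` this is the
Gram square bound `gl2Flat_gram_sq_le` (`n ∈ {1, Q}`), and for `x = y` one has `n(x, x) = Q²`
and equality.  Summing over `Γ × Γ` gives, with `N₂ := Σ_{x, y} n(x, y)`,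
`Σ n² ≤ (Q + 1) N₂ − Q n² + n (Q⁴ − Q³ − Q² + Q)`.  Multiplying by `Q ≥ 0` and inserting the
Bessel count `gl2Flat_bessel_count` (pulled back along the injective coercion `GL₂(K) → M₂(K)`
and with `Σ_u [x·u = y·u] = n(x, y)`), `Q N₂ ≤ Q n² + (Q − 1)(n² + Q³ n)`, multiplied by
`Q + 1 ≥ 0`, yields the claim after the polynomial identity
`2Q⁵ − Q⁴ − 2Q³ + Q² = Q² (Q − 1)(2Q − 1)(Q + 1)`.

This is ingredient (b) of the flat-size lemma of the line's negative programme.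

Sorry-free; axioms `propext`, `Classical.choice`, `Quot.sound`.
-/

set_option linter.dupNamespace false

open scoped BigOperators

namespace Summit.MatrixMultiplication.MatrixMultiplication.Theorems.GradedDesignFamily.Negative

/-- **Arithmetic core.**  If `S ≤ (Q + 1) N - Q n² + n (Q⁴ - Q³ - Q² + Q)`, `0 ≤ Q` and
`Q N ≤ Q n² + (Q - 1)(n² + Q³ n)`, then
`Q S ≤ n² (Q² + Q - 1) + n Q² (Q - 1)(2Q - 1)(Q + 1)` (multiply the first inequality by `Q`, the
last by `Q + 1`, and add). -/
theorem gl2Flat_gram_sum_sq_le_arith (Q n N S : ℝ) (hQ : 0 ≤ Q)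
    (hS : S ≤ (Q + 1) * N - Q * n ^ 2 + n * (Q ^ 4 - Q ^ 3 - Q ^ 2 + Q))
    (hN : Q * N ≤ Q * n ^ 2 + (Q - 1) * (n ^ 2 + Q ^ 3 * n)) :
    Q * S ≤ n ^ 2 * (Q ^ 2 + Q - 1) + n * Q ^ 2 * (Q - 1) * (2 * Q - 1) * (Q + 1) := by
  have h1 := mul_le_mul_of_nonneg_left hS hQ
  have h2 := mul_le_mul_of_nonneg_left hN (by linarith : (0 : ℝ) ≤ Q + 1)
  nlinarith [h1, h2]

/-- **Abstract counting step.**  For a real kernel `f` on a finset `Γ` with `f x x = Q²` on the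
diagonal, `f x y ^ 2 ≤ (Q + 1) f x y - Q` off the diagonal and the Bessel-type bound
`Q Σ f ≤ Q n² + (Q - 1)(n² + Q³ n)` (`n := |Γ|`, `0 ≤ Q`), one has
`Q Σ f² ≤ n² (Q² + Q - 1) + n Q² (Q - 1)(2Q - 1)(Q + 1)`. -/
theorem gl2Flat_gram_sum_sq_le_abstract {α : Type*} [DecidableEq α] (Γ : Finset α)
    (f : α → α → ℝ) (Q : ℝ) (hQ : 0 ≤ Q)
    (hdiag : ∀ x ∈ Γ, f x x = Q ^ 2)
    (hoff : ∀ x ∈ Γ, ∀ y ∈ Γ, x ≠ y → f x y ^ 2 ≤ (Q + 1) * f x y - Q)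
    (hB : Q * ∑ x ∈ Γ, ∑ y ∈ Γ, f x y ≤
      Q * (Γ.card : ℝ) ^ 2 + (Q - 1) * ((Γ.card : ℝ) ^ 2 + Q ^ 3 * Γ.card)) :
    Q * ∑ x ∈ Γ, ∑ y ∈ Γ, f x y ^ 2 ≤
      (Γ.card : ℝ) ^ 2 * (Q ^ 2 + Q - 1) +
        (Γ.card : ℝ) * Q ^ 2 * (Q - 1) * (2 * Q - 1) * (Q + 1) := by
  set c : ℝ := Q ^ 4 - Q ^ 3 - Q ^ 2 + Q with hc
  -- pointwise bound, diagonal and off-diagonal at once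
  have hpt : ∀ x ∈ Γ, ∀ y ∈ Γ,
      f x y ^ 2 ≤ (Q + 1) * f x y - Q + (if x = y then c else 0) := by
    intro x hx y hy
    by_cases hxy : x = y
    · subst hxy
      rw [if_pos rfl, hdiag x hx, hc]
      exact le_of_eq (by ring)
    · rw [if_neg hxy, add_zero]
      exact hoff x hx y hy hxy
  -- row sums of the right-hand side
  have hrow : ∀ x ∈ Γ, ∑ y ∈ Γ, ((Q + 1) * f x y - Q + (if x = y then c else 0)) =
      (Q + 1) * ∑ y ∈ Γ, f x y - (Γ.card : ℝ) * Q + c := by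
    intro x hx
    rw [Finset.sum_add_distrib, Finset.sum_sub_distrib, Finset.sum_ite_eq, if_pos hx,
      Finset.sum_const, nsmul_eq_mul, ← Finset.mul_sum]
  -- sum the pointwise bound over `Γ × Γ`
  have hS : ∑ x ∈ Γ, ∑ y ∈ Γ, f x y ^ 2 ≤
      (Q + 1) * (∑ x ∈ Γ, ∑ y ∈ Γ, f x y) - Q * (Γ.card : ℝ) ^ 2 + (Γ.card : ℝ) * c := by
    calc ∑ x ∈ Γ, ∑ y ∈ Γ, f x y ^ 2
        ≤ ∑ x ∈ Γ, ∑ y ∈ Γ, ((Q + 1) * f x y - Q + (if x = y then c else 0)) :=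
          Finset.sum_le_sum fun x hx => Finset.sum_le_sum fun y hy => hpt x hx y hy
      _ = ∑ x ∈ Γ, ((Q + 1) * ∑ y ∈ Γ, f x y - (Γ.card : ℝ) * Q + c) :=
          Finset.sum_congr rfl hrow
      _ = (Q + 1) * (∑ x ∈ Γ, ∑ y ∈ Γ, f x y) - Q * (Γ.card : ℝ) ^ 2 + (Γ.card : ℝ) * c := by
          rw [Finset.sum_add_distrib, Finset.sum_sub_distrib, Finset.sum_const, Finset.sum_const,
            nsmul_eq_mul, nsmul_eq_mul, ← Finset.mul_sum]
          ring
  exact gl2Flat_gram_sum_sq_le_arith Q Γ.card _ _ hQ hS hB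

/-- **Diagonal Gram entry.**  For `x ∈ GL₂(K)` every `u ∈ K²` satisfies `x·u = x·u`, so
`n(x, x) = |K²| = Q²`. -/
theorem gl2Flat_gram_sum_sq_le_diag {K : Type} [Field K] [Fintype K] [DecidableEq K]
    (x : Matrix.GeneralLinearGroup (Fin 2) K) :
    ((Finset.univ.filter fun u : Fin 2 → K =>
        (x : Matrix (Fin 2) (Fin 2) K).mulVec u = (x : Matrix (Fin 2) (Fin 2) K).mulVec u).card : ℝ) =
      (Fintype.card K : ℝ) ^ 2 := by
  rw [Finset.filter_true_of_mem fun u _ => rfl, Finset.card_univ, Fintype.card_fun,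
    Fintype.card_fin]
  push_cast
  ring

/-- **Bessel count on `GL₂(K)`.**  The Bessel count `gl2Flat_bessel_count` for the image of
`Γ ⊆ GL₂(K)` in `M₂(K)` (the coercion is injective, `Units.ext`), with the sum over `u ∈ K²`
moved inside (`Finset.sum_comm`) and evaluated as `n(x, y)` (`Finset.natCast_card_filter`):
`Q Σ_{x, y ∈ Γ} n(x, y) ≤ Q n² + (Q - 1)(n² + Q³ n)`. -/
theorem gl2Flat_gram_sum_sq_le_bessel {K : Type} [Field K] [Fintype K] [DecidableEq K]
    (Γ : Finset (Matrix.GeneralLinearGroup (Fin 2) K)) :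
    (Fintype.card K : ℝ) * ∑ x ∈ Γ, ∑ y ∈ Γ,
        ((Finset.univ.filter fun u : Fin 2 → K =>
          (x : Matrix (Fin 2) (Fin 2) K).mulVec u = (y : Matrix (Fin 2) (Fin 2) K).mulVec u).card : ℝ) ≤
      (Fintype.card K : ℝ) * (Γ.card : ℝ) ^ 2 +
        ((Fintype.card K : ℝ) - 1) * ((Γ.card : ℝ) ^ 2 + (Fintype.card K : ℝ) ^ 3 * Γ.card) := by
  have hinj : Set.InjOn (fun g : Matrix.GeneralLinearGroup (Fin 2) K => (g : Matrix (Fin 2) (Fin 2) K))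
      ↑Γ := fun a _ b _ h => Units.ext h
  have h := gl2Flat_bessel_count
    (Γ.image fun g : Matrix.GeneralLinearGroup (Fin 2) K => (g : Matrix (Fin 2) (Fin 2) K))
  rw [Finset.card_image_of_injOn hinj] at h
  simp only [Finset.sum_image hinj] at h
  have hswap : ∑ u : Fin 2 → K, ∑ x ∈ Γ, ∑ y ∈ Γ,
      (if (x : Matrix (Fin 2) (Fin 2) K).mulVec u = (y : Matrix (Fin 2) (Fin 2) K).mulVec u
        then (1 : ℝ) else 0) =
      ∑ x ∈ Γ, ∑ y ∈ Γ, ((Finset.univ.filter fun u : Fin 2 → K =>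
        (x : Matrix (Fin 2) (Fin 2) K).mulVec u = (y : Matrix (Fin 2) (Fin 2) K).mulVec u).card : ℝ) := by
    rw [Finset.sum_comm]
    refine Finset.sum_congr rfl fun x _ => ?_
    rw [Finset.sum_comm]
    refine Finset.sum_congr rfl fun y _ => ?_
    rw [Finset.natCast_card_filter]
  rw [hswap] at h
  exact h

/-- **Sum of squared Gram entries (flat-size lemma, ingredient (b)).**  For a finite field `K`
with `Q := |K|` and `Γ ⊆ GL₂(K)` with `n := |Γ|`, the Gram entries
`n(x, y) := #{u ∈ K² : x·u = y·u}` satisfy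
`Q · Σ_{x, y ∈ Γ} n(x, y)² ≤ n² (Q² + Q - 1) + n · Q² (Q - 1)(2Q - 1)(Q + 1)`:
combine `n(x, x) = Q²`, the Gram square bound `gl2Flat_gram_sq_le` off the diagonal and the
Bessel count `gl2Flat_bessel_count`. [folklore] -/
theorem gl2Flat_gram_sum_sq_le : ∀ {K : Type} [Field K] [Fintype K] [DecidableEq K]
    (Γ : Finset (Matrix.GeneralLinearGroup (Fin 2) K)),
    (Fintype.card K : ℝ) *
        ∑ x ∈ Γ, ∑ y ∈ Γ,
          ((Finset.univ.filter fun u : Fin 2 → K =>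
              (x : Matrix (Fin 2) (Fin 2) K).mulVec u = (y : Matrix (Fin 2) (Fin 2) K).mulVec u).card : ℝ) ^ 2 ≤
      (Γ.card : ℝ) ^ 2 * ((Fintype.card K : ℝ) ^ 2 + Fintype.card K - 1) +
        (Γ.card : ℝ) * (Fintype.card K : ℝ) ^ 2 * ((Fintype.card K : ℝ) - 1) *
          (2 * (Fintype.card K : ℝ) - 1) * ((Fintype.card K : ℝ) + 1) := by
  intro K _ _ _ Γ
  refine gl2Flat_gram_sum_sq_le_abstract Γ
    (fun x y => ((Finset.univ.filter fun u : Fin 2 → K =>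
      (x : Matrix (Fin 2) (Fin 2) K).mulVec u = (y : Matrix (Fin 2) (Fin 2) K).mulVec u).card : ℝ))
    (Fintype.card K : ℝ) (Nat.cast_nonneg _) (fun x _ => gl2Flat_gram_sum_sq_le_diag x) ?_
    (gl2Flat_gram_sum_sq_le_bessel Γ)
  intro x _ y _ hxy
  exact gl2Flat_gram_sq_le (x : Matrix (Fin 2) (Fin 2) K) (y : Matrix (Fin 2) (Fin 2) K)
    fun h => hxy (Units.ext h)

end Summit.MatrixMultiplication.MatrixMultiplication.Theorems.GradedDesignFamily.Negative
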